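import Mathlib
import Summits.Ventures.FusionMHD.Models.CerfonFreidbergIterLikeQHalfResDefs
import HarnessLib

/-!
# Ventures/FusionMHD — Models/CerfonFreidbergIterLikeQHalfResPanels1.lean: KERNEL CHECK of the resistive-register certificates of panel(s) 0 (of 32)
# at `ψ_N = 1/2` of THE Cerfon–Freidberg ITER-like instance

HONEST FRAMING (LADDER-GRIDFUSION three columns; CF rung; rider «D_R at ψ_N = 1/2»).  One `decide +kernel` (≈ 60–90 s): for each listed panel the obligation
`CFIterLike.QHalfRes.ResCert.ok` (`Models/CerfonFreidbergIterLikeQHalfResDefs.lean`) — the Taylor-model run of `progR = progM ++ block3R` over ★ #117's parameter box is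
ACCEPTED and the kernel's two panel-integral enclosures (`g_AG`, `g_W` along the approximant) lie inside the claimed integers (compiled `#eval` of the same functions, slack
one unit of `2⁻⁶⁰`; float truth inside every panel, `genqm/truthR.json`).  MODELLED: analytic Cerfon–Freidberg family; nothing about a device or stability.
No `native_decide`.  Typer/prover: gridfusion-model-7 (g7), 2026-08-28.  Citations: Zheng 2015 §3.2 (3.42) [Zheng2015];
Mahboubi–Melquiond–Sibut-Pinote 2016 §3.2 Lemma 3 [MahboubiMelquiondSibutpinote2016].
-/

namespace Summit.Ventures.FusionMHD.Models.CFIterLike.QHalfRes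

/-- Resistive-register certificate data of panel(s) 0. [instance data] -/
def resCert1 : List ResCert := [
  { j := 0, cand1 := [94661745770447339520, 20300713460575428608, 652310595854434566144, 172326083280062447616, 2781981305684470267904, 953911900309397700608, 10304997718563481452544, 3206462384168009990144, 167033857388417669660672, 3532239230908900036313088, -320090681416286845567762432, -4697942099670322203531935744, 246429299941212217602356543488],
    cand2 := [117796729607164919808, 14561371349909327872, 467816733149056139264, 118811589611231903744, 1919346440302088421376, 707253007985819123712, 7652581566071340793856, 3188473547041492959232, 60789689875603155582976, 825948198258458222395392, 54461630361096077745061888, -1843279648690889524108066816, -309160828520355354527137792000],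
    deg := 12, e1 := 42, e2 := 42, glo := 3616587326567043, ghi := 3616587865610366, wlo := 141816587913045334, whi := 141816606115638369 }]

/-- **KERNEL CHECK** of the two resistive registers on panel(s) 0. -/
theorem resCert1_ok : CFIterLike.QHalfRes.resCert1.all ResCert.ok = true := by
  decide +kernel

end Summit.Ventures.FusionMHD.Models.CFIterLike.QHalfRes
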